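import Summits.BirchSwinnertonDyer.BirchSwinnertonDyer.Theorems.SignedLowerHalvesSmallImageLowerHalfBothSignsRttCharRoadE2GlueAlgebra
import Summits.BirchSwinnertonDyer.BirchSwinnertonDyer.Theorems.SignedLowerHalvesSmallImageLowerHalfBothSignsRttCharRoadE2Algebra
import Summits.BirchSwinnertonDyer.Rank1Residual.X2.EulerFactorInvariants
import Literature.NumberTheory.EllipticCurves.Kobayashi2003.SignedColemanKatoZetaAssemblyProofs
import Literature.NumberTheory.EllipticCurves.PadicCoeffIntegersFrobeniusData
import HarnessLib

/-!
# Route `SignedLowerHalves`, crux L `SmallImageLowerHalfBothSigns` (stmt-BirchSwinnertonDyer-23599), line `rtt_w3` v13 — E2, LEAD: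
# THE GLUE `charRoad_E2_of_parts` — the E2-tail's inequality from its four inputs (E2-PT, E2-K, Col, E2-an) in their binder shapes

WHY (BRIEF-E2 rev 2.1 §2–§5, `Lines/rtt_w3-BRIEF-E2-g8.md`). After v13 the registered research stub `stub_charRoad_ns` is the E2-tail: for
the dual `X` of the saturated transported signed Selmer group of the partner character `θ` over `K_∞` and Pollack's `L ∈ Λ_{𝒪_g} ∖ 0`,
`[ℚ_p(S):ℚ_p]·(d(L) + Σ_{v∈S₀} p^{v_p(f_{ℓ_v})}·λ(P_{g,ℓ_v}(ℓ_v⁻¹(1+X)))) ≤ λ(X)`. Its cut of record reads this off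
(PT) a four-term exact sequence `𝐇¹ →ᶠ 𝒬 →ᵍ X →ʰ 𝐇² → 0` of modules over `Λ_𝒪 = 𝒪_S⟦T⟧` (`𝒬 = 𝐇¹_v/E^ε`, resp. `(𝒰_∞/V^∓)_θ`),
(K) `𝐇¹` torsion-free of `Λ_𝒪`-rank `≤ 1` and `λ(𝐇¹/Λ_𝒪 z) ≤ λ(𝐇²)` for the zeta element `z`, (Col) `Col : 𝒬 ≃ Λ_𝒪`, and
(an) `Col(f z) = c · L · ∏_{v∈S₀} P_{g,ℓ_v}(ℓ_v⁻¹(1+T)^{f_v})` in `ℚ̄_p⟦T⟧`. This file is the GLUE: from inputs of exactly these shapes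
(arbitrary carriers `H, Q, X', Y`; the `Λ = ℤ_p⟦T⟧`-structures obtained from any `[Algebra Λ Λ_𝒪]` whose structure map is the tree's
`iwasawaToIwasawaO S`) it proves the E2-tail's conclusion with `λ(X')` on the right (`charRoad_E2_of_parts`), through

* the companion file `…RttCharRoadE2GlueAlgebra` (§1–§2 there: `Λ_𝒪` finite over `Λ`, `Λ_𝒪/(a)` finitely generated torsion, and
  `λ(Λ_𝒪/(a)) = [ℚ_p(S):ℚ_p]·D` under (an) — -w3 g19's E2-num headline p775021 in the scalar-tower currency);
* §1 `lambdaInvariant_quotient_span_le_of_parts`: the module-theoretic core — injectivity of `f` from (K)+(an)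
  (`Kobayashi2003.injective_of_rank_le_one_of_ne_zero`), `Q ⧸ f(Λ_𝒪 z) ≃ₗ[Λ] Λ_𝒪/(Col (f z))`, then the landed four-term `λ`-algebra
  `SmallImageCharSignedSelmer.lambdaInvariant_quotient_map_le_of_fourTerm` (p773570);
* §2 `charRoad_E2_of_parts` (crux currency: `L ∈ IwasawaAlgebraO (range ι)`, the stub's Euler polynomials, `∃ d`), and the transfer
  lemma `lambdaInvariant_eq_of_addEquiv` (`λ` along an additive bijection commuting with the constants `C ℤ_p` — e.g. `X' ≅ Dψ.X` up to
  the involution `γ ↦ γ⁻¹`).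

HONEST FRAMING: `--supports` helper, THEOREMS ONLY (no definition, no named fact, no instance, no `sorry`); the inputs (PT)/(K)/(Col)/(an)
are HYPOTHESES here — the research content of E2 — and nothing about them is proved; crux L, crux M, E2 and BSD remain OPEN and are proved
for NO curve by any of this. [cite: Kobayashi2003, Thm. 7.3 i), Thm. 1.3] [cite: PollackRubin2004, §7, Theorem (p. 448)] [cite: Washington1997, §13.2]
-/

set_option linter.dupNamespace false -- D-0017: single-problem summit, the namespace repeats the problem name by design
set_option autoImplicit false

noncomputable section

open scoped Classical TensorProduct

namespace Summit.BirchSwinnertonDyer.BirchSwinnertonDyer.Theorems.SmallImageRttCharRoad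

open PowerSeries Literature.NumberTheory.EllipticCurves Literature.NumberTheory.IwasawaTheory
  Literature.NumberTheory.EllipticCurves.GreenbergVatsal2000

/-! ## §1. The module-theoretic core: `λ(Λ_𝒪/(Col (f z))) ≤ λ(X')` from (PT) + (K) + (Col) + `Col (f z) ≠ 0` -/

section Core

variable {p : ℕ} [Fact p.Prime] {S : Set (PadicAlgCl p)} [FiniteDimensional ℚ_[p] (padicCoeffField S)]
  [Algebra (IwasawaAlgebra p) (IwasawaAlgebraO S)]

/-- **The E2 glue, module form.** Data: `Λ_𝒪`-modules `H, Q` carrying compatible `Λ`-structures, `Λ`-modules `X', Y`, maps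
`f : H →ₗ[Λ_𝒪] Q`, `g : Q →ₗ[Λ] X'`, `h : X' →ₗ[Λ] Y` with `H →ᶠ Q →ᵍ X' →ʰ Y → 0` exact (E2-PT), `X'` finitely generated torsion,
`H` torsion-free of `Λ_𝒪`-rank `≤ 1` with `λ(H/Λ_𝒪 z) ≤ λ(Y)` (E2-K), `Col : Q ≃ₗ[Λ_𝒪] Λ_𝒪` (the `±`-Coleman map) with `Col(f z) ≠ 0`.
Then `λ(Λ_𝒪/(Col (f z))) ≤ λ(X')`: `f` is injective (Kobayashi's «non-zero on a torsion-free rank-one module»,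
`Kobayashi2003.injective_of_rank_le_one_of_ne_zero`), `Q ⧸ f(Λ_𝒪 z) ≅ Λ_𝒪/(Col (f z))` is finitely generated torsion over `Λ` (companion file), and the
landed four-term `λ`-algebra `SmallImageCharSignedSelmer.lambdaInvariant_quotient_map_le_of_fourTerm` (p773570) concludes.
[cite: Kobayashi2003, Thm. 7.3 i), Thm. 1.3] [cite: Washington1997, §13.2] -/
theorem lambdaInvariant_quotient_span_le_of_parts
    (halg : ∀ r : IwasawaAlgebra p, algebraMap (IwasawaAlgebra p) (IwasawaAlgebraO S) r = iwasawaToIwasawaO S r)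
    {H Q X' Y : Type} [AddCommGroup H] [AddCommGroup Q] [AddCommGroup X'] [AddCommGroup Y]
    [Module (IwasawaAlgebraO S) H] [Module (IwasawaAlgebra p) H] [IsScalarTower (IwasawaAlgebra p) (IwasawaAlgebraO S) H]
    [Module (IwasawaAlgebraO S) Q] [Module (IwasawaAlgebra p) Q] [IsScalarTower (IwasawaAlgebra p) (IwasawaAlgebraO S) Q]
    [Module (IwasawaAlgebra p) X'] [Module (IwasawaAlgebra p) Y]
    [Module.Finite (IwasawaAlgebra p) X'] (hX' : Module.IsTorsion (IwasawaAlgebra p) X')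
    (f : H →ₗ[IwasawaAlgebraO S] Q) (g : Q →ₗ[IwasawaAlgebra p] X') (h : X' →ₗ[IwasawaAlgebra p] Y)
    (hfg : Function.Exact f g) (hgh : Function.Exact g h) (hh : Function.Surjective h)
    [NoZeroSMulDivisors (IwasawaAlgebraO S) H] (hrank : Module.rank (IwasawaAlgebraO S) H ≤ 1) (z : H)
    (hK : lambdaInvariant p (H ⧸ Submodule.span (IwasawaAlgebraO S) {z}) ≤ lambdaInvariant p Y)
    (Col : Q ≃ₗ[IwasawaAlgebraO S] IwasawaAlgebraO S) (hz : Col (f z) ≠ 0) :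
    lambdaInvariant p (IwasawaAlgebraO S ⧸ Ideal.span {Col (f z)}) ≤ lambdaInvariant p X' := by
  -- (K) + (an): `f` is injective
  have hf : Function.Injective f := by
    have hc : (Col : Q →ₗ[IwasawaAlgebraO S] IwasawaAlgebraO S) ∘ₗ f ≠ 0 := fun h0 ↦
      hz (by simpa using LinearMap.congr_fun h0 z)
    have hinj := Kobayashi2003.injective_of_rank_le_one_of_ne_zero hrank _ hc
    rw [LinearMap.coe_comp] at hinj
    exact hinj.of_comp
  -- the `Λ`-linear data fed to the four-term algebra
  set f' : H →ₗ[IwasawaAlgebra p] Q := f.restrictScalars (IwasawaAlgebra p) with hf'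
  set Z : Submodule (IwasawaAlgebra p) H :=
    (Submodule.span (IwasawaAlgebraO S) {z}).restrictScalars (IwasawaAlgebra p) with hZ
  -- `Q ⧸ Z.map f' ≃ₗ[Λ] Λ_𝒪/(Col (f z))`
  have hmapO : (Submodule.span (IwasawaAlgebraO S) {z}).map f = Submodule.span (IwasawaAlgebraO S) {f z} := by
    rw [Submodule.map_span, Set.image_singleton]
  have hmap : Z.map f' = (Submodule.span (IwasawaAlgebraO S) {f z}).restrictScalars (IwasawaAlgebra p) := by
    ext x
    rw [Submodule.restrictScalars_mem, ← hmapO, Submodule.mem_map, Submodule.mem_map]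
    simp only [hZ, hf', Submodule.restrictScalars_mem, LinearMap.restrictScalars_apply]
  have hCol : (Submodule.span (IwasawaAlgebraO S) {f z}).map (Col : Q →ₗ[IwasawaAlgebraO S] IwasawaAlgebraO S) =
      Ideal.span {Col (f z)} := by
    rw [Submodule.map_span, Set.image_singleton, ← Ideal.submodule_span_eq]
    rfl
  let e : (Q ⧸ Z.map f') ≃ₗ[IwasawaAlgebra p] (IwasawaAlgebraO S ⧸ Ideal.span {Col (f z)}) :=
    (Submodule.quotEquivOfEq _ _ hmap).trans
      ((Submodule.Quotient.restrictScalarsEquiv (IwasawaAlgebra p) (Submodule.span (IwasawaAlgebraO S) {f z})).symm.trans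
        ((Submodule.Quotient.equiv _ _ Col hCol).restrictScalars (IwasawaAlgebra p)))
  -- `Q ⧸ Z.map f'` is finitely generated torsion over `Λ`
  haveI : Module.Finite (IwasawaAlgebra p) (IwasawaAlgebraO S ⧸ Ideal.span {Col (f z)}) :=
    moduleFinite_iwasawaAlgebraO_quotient_span_singleton S halg _
  haveI : Module.Finite (IwasawaAlgebra p) (Q ⧸ Z.map f') := Module.Finite.equiv e.symm
  have hQt : Module.IsTorsion (IwasawaAlgebra p) (Q ⧸ Z.map f') := fun x ↦ by
    obtain ⟨r, hr⟩ := @isTorsion_iwasawaAlgebraO_quotient_span_singleton p _ S _ _ halg _ hz (e x)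
    refine ⟨r, e.injective ?_⟩
    rw [map_zero, Submonoid.smul_def, map_smul, ← Submonoid.smul_def]
    exact hr
  -- (K) in the `Λ`-submodule currency
  have hK' : lambdaInvariant p (H ⧸ Z) ≤ lambdaInvariant p Y := by
    rwa [lambdaInvariant_eq_of_linearEquiv
      (Submodule.Quotient.restrictScalarsEquiv (IwasawaAlgebra p) (Submodule.span (IwasawaAlgebraO S) {z}))]
  -- the four-term `λ`-algebra (p773570)
  have hmain := SmallImageCharSignedSelmer.lambdaInvariant_quotient_map_le_of_fourTerm p f' g h hX'
    (fun y ↦ hfg y) hgh hh (fun x y hxy ↦ hf hxy) Z hQt hK'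
  rwa [lambdaInvariant_eq_of_linearEquiv e] at hmain

/-- **`λ` along an additive bijection commuting with the constants.** If `e : M ≃+ N` between `Λ`-modules satisfies
`e(C c • x) = C c • e x` for all `c ∈ ℤ_p`, then `λ(M) = λ(N)` — `λ = dim_{ℚ_p}(ℚ_p ⊗_{ℤ_p} ·)` only sees the `ℤ_p`-structure. (Use: the
comparison of the `X'` of the four-term sequence with the stub's `Dψ.X`, which may be `Λ`-antilinear — `γ ↦ γ⁻¹` — but is always
`ℤ_p`-linear.) [cite: Washington1997, §13.2] [folklore] -/
theorem lambdaInvariant_eq_of_addEquiv {M N : Type*} [AddCommGroup M] [Module (IwasawaAlgebra p) M] [AddCommGroup N]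
    [Module (IwasawaAlgebra p) N] (e : M ≃+ N)
    (he : ∀ (c : ℤ_[p]) (x : M), e ((PowerSeries.C c : IwasawaAlgebra p) • x) = (PowerSeries.C c : IwasawaAlgebra p) • e x) :
    lambdaInvariant p M = lambdaInvariant p N := by
  let e' : RestrictScalars ℤ_[p] (IwasawaAlgebra p) M ≃ₗ[ℤ_[p]] RestrictScalars ℤ_[p] (IwasawaAlgebra p) N :=
    { ((RestrictScalars.addEquiv ℤ_[p] (IwasawaAlgebra p) M).trans e).trans
        (RestrictScalars.addEquiv ℤ_[p] (IwasawaAlgebra p) N).symm with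
      map_smul' := fun c x ↦ by
        change e ((algebraMap ℤ_[p] (IwasawaAlgebra p) c) • (RestrictScalars.addEquiv ℤ_[p] (IwasawaAlgebra p) M x)) =
          (algebraMap ℤ_[p] (IwasawaAlgebra p) c) • e (RestrictScalars.addEquiv ℤ_[p] (IwasawaAlgebra p) M x)
        rw [PowerSeries.algebraMap_apply, Algebra.algebraMap_self_apply]
        exact he c _ }
  unfold lambdaInvariant
  exact (e'.baseChange ℤ_[p] ℚ_[p] _ _).finrank_eq

end Core

/-! ## §2. The glue in the crux's currency: `charRoad_E2_of_parts` -/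

section Crux

open scoped MatrixGroups ModularForm
open CongruenceSubgroup NumberField IsDedekindDomain Rat.HeightOneSpectrum
  Literature.NumberTheory.EllipticCurves.ModularForms

variable {p : ℕ} [Fact p.Prime] {S : Set (PadicAlgCl p)} [Algebra (IwasawaAlgebra p) (IwasawaAlgebraO S)]

/-- **The E2 glue with free Euler data.** As `charRoad_E2_of_parts`, but the analytic identification (an) may present
`Col(f z)` with ANY Euler data `(P_v, u_v, f_v)_{v∈S₀}` (`P_v, u_v, f_v ≠ 0`) and any `L' ∈ ℚ̄_p⟦T⟧ ∖ 0` with leading index `d`: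
`[ℚ_p(S):ℚ_p]·(d + Σ_{v∈S₀} p^{v_p(f_v)}·layerLambda(P_v.comp (C u_v * (X + 1)))) ≤ λ(X')`. [cite: Kobayashi2003, Thm. 7.3 i), Thm. 1.3]
[cite: GreenbergVatsal2000, §2 Prop. (2.4)] [cite: Washington1997, §13.2] -/
theorem lambdaInvariant_ge_of_parts_eulerData (hS : 0 < Module.finrank ℚ_[p] (padicCoeffField S))
    (halg : ∀ r : IwasawaAlgebra p, algebraMap (IwasawaAlgebra p) (IwasawaAlgebraO S) r = iwasawaToIwasawaO S r)
    {H Q X' Y : Type} [AddCommGroup H] [AddCommGroup Q] [AddCommGroup X'] [AddCommGroup Y]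
    [Module (IwasawaAlgebraO S) H] [Module (IwasawaAlgebra p) H] [IsScalarTower (IwasawaAlgebra p) (IwasawaAlgebraO S) H]
    [Module (IwasawaAlgebraO S) Q] [Module (IwasawaAlgebra p) Q] [IsScalarTower (IwasawaAlgebra p) (IwasawaAlgebraO S) Q]
    [Module (IwasawaAlgebra p) X'] [Module (IwasawaAlgebra p) Y]
    [Module.Finite (IwasawaAlgebra p) X'] (hX' : Module.IsTorsion (IwasawaAlgebra p) X')
    (f : H →ₗ[IwasawaAlgebraO S] Q) (g : Q →ₗ[IwasawaAlgebra p] X') (h : X' →ₗ[IwasawaAlgebra p] Y)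
    (hfg : Function.Exact f g) (hgh : Function.Exact g h) (hh : Function.Surjective h)
    [NoZeroSMulDivisors (IwasawaAlgebraO S) H] (hrank : Module.rank (IwasawaAlgebraO S) H ≤ 1) (z : H)
    (hK : lambdaInvariant p (H ⧸ Submodule.span (IwasawaAlgebraO S) {z}) ≤ lambdaInvariant p Y)
    (Col : Q ≃ₗ[IwasawaAlgebraO S] IwasawaAlgebraO S)
    {ι' : Type*} (s : Finset ι') {c : PadicAlgCl p} (hc : c ≠ 0) {L' : PowerSeries (PadicAlgCl p)} (hL' : L' ≠ 0) {d : ℕ}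
    (hle : ∀ k, ‖PowerSeries.coeff k L'‖ ≤ ‖PowerSeries.coeff d L'‖)
    (hlt : ∀ k, k < d → ‖PowerSeries.coeff k L'‖ < ‖PowerSeries.coeff d L'‖)
    (P : ι' → Polynomial (PadicAlgCl p)) (u : ι' → PadicAlgCl p) (fv : ι' → ℤ_[p])
    (hP : ∀ v ∈ s, P v ≠ 0) (hu : ∀ v ∈ s, u v ≠ 0) (hfv : ∀ v ∈ s, fv v ≠ 0)
    (hCol : iwasawaOToPowerSeries S (Col (f z)) = PowerSeries.C c * L' *
      ∏ v ∈ s, Polynomial.aeval (PowerSeries.C (u v) *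
        (PowerSeries.binomialSeries ℤ_[p] (fv v)).map (algebraMap ℤ_[p] (PadicAlgCl p))) (P v)) :
    Module.finrank ℚ_[p] (padicCoeffField S) *
        (d + ∑ v ∈ s, p ^ (fv v).valuation * layerLambda ((P v).comp (Polynomial.C (u v) * (Polynomial.X + 1)))) ≤
      lambdaInvariant p X' := by
  haveI : FiniteDimensional ℚ_[p] (padicCoeffField S) := Module.finite_of_finrank_pos hS
  rw [← lambdaInvariant_quotient_span_eq_of_eulerProduct S halg s hc hL' hle hlt P u fv hP hu hfv hCol]
  exact lambdaInvariant_quotient_span_le_of_parts halg hX' f g h hfg hgh hh hrank z hK Col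
    (ne_zero_of_eulerProduct S s hc hL' hle hlt P u fv hP hu hfv hCol)

/-- **The E2 glue `charRoad_E2_of_parts` (line `rtt_w3`, BRIEF-E2 §5).** For the crux's data — `𝒪 = 𝒪_{ℚ_p(S)}` with
`0 < [ℚ_p(S):ℚ_p]`, a newform `g` of level `Γ₀(M)` with `ι : K_g → ℚ̄_p`, the depletion set `S₀ ∌ (p)`, and Pollack's
`L ∈ Λ_{𝒪_g} ∖ 0` — and INPUTS in the shapes the cut of record asks for:
(PT) `Λ_𝒪`-modules `H, Q` (with the scalar-tower `Λ`-structures), `Λ`-modules `X', Y`, `f : H →ₗ[Λ_𝒪] Q`, `g : Q →ₗ[Λ] X'`,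
`h : X' →ₗ[Λ] Y`, `H →ᶠ Q →ᵍ X' →ʰ Y → 0` exact, `X'` finitely generated torsion; (K) `H` without `Λ_𝒪`-torsion, of `Λ_𝒪`-rank `≤ 1`,
`λ(H/Λ_𝒪 z) ≤ λ(Y)`; (Col) `Col : Q ≃ₗ[Λ_𝒪] Λ_𝒪`; (an) `Col(f z) = C c · L · ∏_{v∈S₀} P_{g,ℓ_v}(ℓ_v⁻¹(1+T)^{f_v})` in `ℚ̄_p⟦T⟧` with
`c ≠ 0` and exponents `f_v ∈ ℤ_p ∖ 0` of valuation `v_p(frobeniusExponent p ℓ_v)` —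
the E2-tail's conclusion holds with `λ(X')` on the right:
`∃ d, (leading-index clauses of L at d) ∧ [ℚ_p(S):ℚ_p]·(d + Σ_{v∈S₀} p^{v_p(f_{ℓ_v})}·layerLambda(P_{g,ℓ_v}(ℓ_v⁻¹(X+1)))) ≤ λ(X')`
(text of `stub_charRoad_ns` v13 after `∀ L, L ≠ 0 → congruence →`, with `Dψ.X ↦ X'`; transfer to `Dψ.X` by `lambdaInvariant_eq_of_addEquiv`
or `lambdaInvariant_eq_of_linearEquiv`). The inputs are the research content of E2 and are NOT proved here.
[cite: Kobayashi2003, Thm. 7.3 i), Thm. 1.3] [cite: PollackRubin2004, §7, Theorem (p. 448)] [cite: GreenbergVatsal2000, §2 Prop. (2.4)] -/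
theorem charRoad_E2_of_parts (hS : 0 < Module.finrank ℚ_[p] (padicCoeffField S))
    (halg : ∀ r : IwasawaAlgebra p, algebraMap (IwasawaAlgebra p) (IwasawaAlgebraO S) r = iwasawaToIwasawaO S r)
    {M : ℕ} [NeZero M] (g : CuspForm (Gamma0 M) 2) (ι : coeffField g →+* PadicAlgCl p) (hng : IsNewform0 g)
    (S₀ : Finset (HeightOneSpectrum (𝓞 ℚ)))
    {H Q X' Y : Type} [AddCommGroup H] [AddCommGroup Q] [AddCommGroup X'] [AddCommGroup Y]
    [Module (IwasawaAlgebraO S) H] [Module (IwasawaAlgebra p) H] [IsScalarTower (IwasawaAlgebra p) (IwasawaAlgebraO S) H]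
    [Module (IwasawaAlgebraO S) Q] [Module (IwasawaAlgebra p) Q] [IsScalarTower (IwasawaAlgebra p) (IwasawaAlgebraO S) Q]
    [Module (IwasawaAlgebra p) X'] [Module (IwasawaAlgebra p) Y]
    [Module.Finite (IwasawaAlgebra p) X'] (hX' : Module.IsTorsion (IwasawaAlgebra p) X')
    (f : H →ₗ[IwasawaAlgebraO S] Q) (gX : Q →ₗ[IwasawaAlgebra p] X') (h : X' →ₗ[IwasawaAlgebra p] Y)
    (hfg : Function.Exact f gX) (hgh : Function.Exact gX h) (hh : Function.Surjective h)
    [NoZeroSMulDivisors (IwasawaAlgebraO S) H] (hrank : Module.rank (IwasawaAlgebraO S) H ≤ 1) (z : H)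
    (hK : lambdaInvariant p (H ⧸ Submodule.span (IwasawaAlgebraO S) {z}) ≤ lambdaInvariant p Y)
    (Col : Q ≃ₗ[IwasawaAlgebraO S] IwasawaAlgebraO S)
    (L : IwasawaAlgebraO (Set.range ι)) (hL : L ≠ 0) {c : PadicAlgCl p} (hc : c ≠ 0)
    (fv : HeightOneSpectrum (𝓞 ℚ) → ℤ_[p])
    (hfv : ∀ v ∈ S₀, fv v ≠ 0 ∧ (fv v).valuation = (frobeniusExponent p (natGenerator v : ℤ_[p])).valuation)
    (hCol : iwasawaOToPowerSeries S (Col (f z)) =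
      PowerSeries.C c * iwasawaOToPowerSeries (Set.range ι) L *
        ∏ v ∈ S₀, Polynomial.aeval (PowerSeries.C ((natGenerator v : PadicAlgCl p)⁻¹) *
            (PowerSeries.binomialSeries ℤ_[p] (fv v)).map (algebraMap ℤ_[p] (PadicAlgCl p)))
          (1 - Polynomial.C (embCoeff g ι (natGenerator v)) * Polynomial.X +
            (if natGenerator v ∣ M then 0 else Polynomial.C (natGenerator v : PadicAlgCl p)) * Polynomial.X ^ 2)) :
    ∃ d : ℕ, (∀ k : ℕ, ‖PowerSeries.coeff k (iwasawaOToPowerSeries (Set.range ι) L)‖ ≤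
        ‖PowerSeries.coeff d (iwasawaOToPowerSeries (Set.range ι) L)‖) ∧
      (∀ k : ℕ, k < d → ‖PowerSeries.coeff k (iwasawaOToPowerSeries (Set.range ι) L)‖ <
        ‖PowerSeries.coeff d (iwasawaOToPowerSeries (Set.range ι) L)‖) ∧
      Module.finrank ℚ_[p] (padicCoeffField S) * (d + ∑ v ∈ S₀, p ^ (frobeniusExponent p (natGenerator v : ℤ_[p])).valuation *
        layerLambda ((1 - Polynomial.C (embCoeff g ι (natGenerator v)) * Polynomial.X +
          (if natGenerator v ∣ M then 0 else Polynomial.C (natGenerator v : PadicAlgCl p)) * Polynomial.X ^ 2).comp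
            (Polynomial.C ((natGenerator v : PadicAlgCl p)⁻¹) * (Polynomial.X + 1)))) ≤ lambdaInvariant p X' := by
  haveI : FiniteDimensional ℚ (coeffField g) := IsNewform0.finiteDimensional_coeffField_holds hng
  haveI : FiniteDimensional ℚ_[p] (padicCoeffField (Set.range ι)) := GreenbergSelmer.finiteDimensional_padicCoeffField ι
  obtain ⟨d, hle, hlt⟩ := SmallImageRttE2Num.exists_normLambda_iwasawaAlgebraO p (Set.range ι) L hL
  refine ⟨d, hle, hlt, ?_⟩
  have hL' : iwasawaOToPowerSeries (Set.range ι) L ≠ 0 :=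
    (map_ne_zero_iff _ (iwasawaOToPowerSeries_injective _)).mpr hL
  have hP : ∀ v ∈ S₀, (1 - Polynomial.C (embCoeff g ι (natGenerator v)) * Polynomial.X +
      (if natGenerator v ∣ M then 0 else Polynomial.C (natGenerator v : PadicAlgCl p)) * Polynomial.X ^ 2) ≠ 0 :=
    fun v _ h0 ↦ by
      have h1 := congrArg (fun P : Polynomial (PadicAlgCl p) ↦ P.coeff 0) h0
      simp only [Polynomial.coeff_add, Polynomial.coeff_sub, Polynomial.coeff_one_zero, Polynomial.coeff_C_mul,
        Polynomial.coeff_X_zero, mul_zero, sub_zero, Polynomial.coeff_zero] at h1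
      split_ifs at h1 with hd
      · simp only [zero_mul, Polynomial.coeff_zero, add_zero, one_ne_zero] at h1
      · simp only [Polynomial.coeff_C_mul, Polynomial.coeff_X_pow, mul_ite, mul_one, mul_zero] at h1
        norm_num at h1
  have hu : ∀ v ∈ S₀, ((natGenerator v : PadicAlgCl p))⁻¹ ≠ 0 := fun v _ ↦
    inv_ne_zero (Nat.cast_ne_zero.mpr (prime_natGenerator v).ne_zero)
  have hmain := lambdaInvariant_ge_of_parts_eulerData hS halg hX' f gX h hfg hgh hh hrank z hK Col S₀ hc hL' hle hlt
    (fun v ↦ 1 - Polynomial.C (embCoeff g ι (natGenerator v)) * Polynomial.X +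
      (if natGenerator v ∣ M then 0 else Polynomial.C (natGenerator v : PadicAlgCl p)) * Polynomial.X ^ 2)
    (fun v ↦ ((natGenerator v : PadicAlgCl p))⁻¹) fv hP hu (fun v hv ↦ (hfv v hv).1) hCol
  have hsum : ∑ v ∈ S₀, p ^ (fv v).valuation *
        layerLambda ((1 - Polynomial.C (embCoeff g ι (natGenerator v)) * Polynomial.X +
          (if natGenerator v ∣ M then 0 else Polynomial.C (natGenerator v : PadicAlgCl p)) * Polynomial.X ^ 2).comp
            (Polynomial.C ((natGenerator v : PadicAlgCl p)⁻¹) * (Polynomial.X + 1))) =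
      ∑ v ∈ S₀, p ^ (frobeniusExponent p (natGenerator v : ℤ_[p])).valuation *
        layerLambda ((1 - Polynomial.C (embCoeff g ι (natGenerator v)) * Polynomial.X +
          (if natGenerator v ∣ M then 0 else Polynomial.C (natGenerator v : PadicAlgCl p)) * Polynomial.X ^ 2).comp
            (Polynomial.C ((natGenerator v : PadicAlgCl p)⁻¹) * (Polynomial.X + 1))) :=
    Finset.sum_congr rfl fun v hv ↦ by rw [(hfv v hv).2]
  rw [← hsum]
  exact hmain

/-- The exponents of record `f_v = frobeniusExponent p ℓ_v` satisfy the side conditions of `charRoad_E2_of_parts` for `v ∤ p`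
(`ℓ_v = natGenerator v ≠ p`, a prime, is not a root of unity in `ℤ_p`). [cite: GreenbergVatsal2000, §1 p. 9 (f_ℓ)] -/
theorem frobeniusExponent_natGenerator_ne_zero {v : HeightOneSpectrum (𝓞 ℚ)} (hv : ((p : ℕ) : 𝓞 ℚ) ∉ v.asIdeal) :
    frobeniusExponent p (natGenerator v : ℤ_[p]) ≠ 0 := by
  obtain ⟨hcop, h1⟩ := Summit.BirchSwinnertonDyer.Rank1Residual.X2.EulerFactorInvariants.coprime_natGenerator v
    (Summit.BirchSwinnertonDyer.Rank1Residual.X2.EulerFactorInvariants.natGenerator_ne_of_natCast_not_mem v hv)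
  exact Summit.BirchSwinnertonDyer.Rank1Residual.X2.EulerFactorAlgebra.frobeniusExponent_natCast_ne_zero hcop h1

end Crux

end Summit.BirchSwinnertonDyer.BirchSwinnertonDyer.Theorems.SmallImageRttCharRoad

end
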